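import Summits.AtomisticToContinuum.HydrodynamicLimit.Theorems.LambertianContactSwapLambertianEulerCollisionalHeartOfInputs
import Summits.AtomisticToContinuum.HydrodynamicLimit.Theorems.LambertianContactSwapLambertianEulerGaussianTailsCore
import Summits.AtomisticToContinuum.HydrodynamicLimit.Theorems.LambertianContactSwapLambertianEulerGaussianTailsExpMoment
import Summits.AtomisticToContinuum.HydrodynamicLimit.Theorems.LambertianContactSwapLambertianEulerGaussianTailsEquilibrium
import Summits.AtomisticToContinuum.HydrodynamicLimit.Theorems.LambertianContactSwapLambertianEulerJcolPairBound
import Summits.AtomisticToContinuum.HydrodynamicLimit.Theorems.LambertianContactSwapLambertianEulerCollisionActivityCore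
import Summits.AtomisticToContinuum.HydrodynamicLimit.Theorems.LambertianContactSwapLambertianEulerOfHearts
import Summits.AtomisticToContinuum.HydrodynamicLimit.Theorems.LambertianContactSwapLambertianEulerInBandOfHearts
import Summits.AtomisticToContinuum.HydrodynamicLimit.Theorems.LambertianContactSwapLambertianEulerKineticHeartOfInputs
import Summits.AtomisticToContinuum.HydrodynamicLimit.Theorems.LambertianContactSwapLambertianEulerKineticWindowTools
import Summits.AtomisticToContinuum.HydrodynamicLimit.Theorems.LambertianContactSwapLambertianEulerKineticInputs
import Summits.AtomisticToContinuum.HydrodynamicLimit.Theorems.LambertianContactSwapLambertianEulerKineticArith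
import Summits.AtomisticToContinuum.HydrodynamicLimit.Theorems.LambertianContactSwapLambertianEulerOfHeartsInBand
import Summits.AtomisticToContinuum.HydrodynamicLimit.Theorems.LambertianContactSwapLambertianEulerEstimateOfHeartsLog
import Summits.AtomisticToContinuum.HydrodynamicLimit.Theorems.LambertianContactSwapLambertianEulerDockRfInBand
import Summits.AtomisticToContinuum.HydrodynamicLimit.Theorems.LambertianContactSwapLambertianEulerHeartsLog
import Summits.AtomisticToContinuum.HydrodynamicLimit.Theorems.LambertianContactSwapLambertianEulerDiscreteEntropyGronwallLog
import Summits.AtomisticToContinuum.HydrodynamicLimit.Theorems.LambertianContactSwapLambertianEulerBootstrapConsts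
import Summits.AtomisticToContinuum.HydrodynamicLimit.Theorems.LambertianContactSwapLambertianEulerWindowEntropyInequality
import Summits.AtomisticToContinuum.HydrodynamicLimit.Theorems.LambertianContactSwapLambertianEulerOrthogonalCurrentsMean
import Summits.AtomisticToContinuum.HydrodynamicLimit.Theses.LambertianContactSwap
import Summits.AtomisticToContinuum.HydrodynamicLimit.Theses.LindebergRandomFuture
import Summits.AtomisticToContinuum.HydrodynamicLimit.Theorems.LambertianContactSwapLambertianEulerArchimedes
import Summits.AtomisticToContinuum.HydrodynamicLimit.Theorems.LambertianContactSwapLambertianEulerLambertLaw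
import Summits.AtomisticToContinuum.HydrodynamicLimit.Theorems.LambertianContactSwapLambertianEulerPovzner
import Summits.AtomisticToContinuum.HydrodynamicLimit.Theorems.LambertianContactSwapLambertianEulerPairPovzner
import Summits.AtomisticToContinuum.HydrodynamicLimit.Theorems.LambertianContactSwapLambertianEulerContactIsotropy
import Summits.AtomisticToContinuum.HydrodynamicLimit.Theorems.LambertianContactSwapLambertianEulerMomentLedgerChain
import Summits.AtomisticToContinuum.HydrodynamicLimit.Theorems.LambertianContactSwapLambertianEulerGibbsInvariance
import Summits.AtomisticToContinuum.HydrodynamicLimit.Theorems.LambertianContactSwapLambertianEulerEntropyToHydro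
import Summits.AtomisticToContinuum.HydrodynamicLimit.Theorems.LambertianContactSwapLambertianEulerWindow
import Summits.AtomisticToContinuum.HydrodynamicLimit.Theorems.LambertianContactSwapLambertianEulerMarkov
import Summits.AtomisticToContinuum.HydrodynamicLimit.Theorems.LambertianContactSwapLambertianEulerIterate
import Summits.AtomisticToContinuum.HydrodynamicLimit.Theorems.LambertianContactSwapLambertianEulerDock
import Summits.AtomisticToContinuum.HydrodynamicLimit.Theorems.LambertianContactSwapLambertianEulerKlLedger
import Summits.AtomisticToContinuum.HydrodynamicLimit.Theorems.LambertianContactSwapLambertianEulerLawSemigroup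
import Summits.AtomisticToContinuum.HydrodynamicLimit.Theorems.LambertianContactSwapLambertianEulerDockRf
import Summits.AtomisticToContinuum.HydrodynamicLimit.Theorems.LambertianContactSwapLambertianEulerLambertDirMean
import Summits.AtomisticToContinuum.HydrodynamicLimit.Theorems.LambertianContactSwapLambertianEulerPairMeanSq
import Summits.AtomisticToContinuum.HydrodynamicLimit.Theorems.LambertianContactSwapLambertianEulerPathwiseProduction
import Summits.AtomisticToContinuum.HydrodynamicLimit.Theorems.LambertianContactSwapLambertianEulerWindowLedger
import Summits.AtomisticToContinuum.HydrodynamicLimit.Theorems.LambertianContactSwapLambertianEulerCollisionCompensator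
import Summits.AtomisticToContinuum.HydrodynamicLimit.Theorems.LambertianContactSwapLambertianEulerCompensatedJump
import Summits.AtomisticToContinuum.HydrodynamicLimit.Theorems.LambertianContactSwapLambertianEulerAprioriEntropyBound
import Summits.AtomisticToContinuum.HydrodynamicLimit.Theorems.LambertianContactSwapLambertianEulerCollisionIntensity
import Summits.AtomisticToContinuum.HydrodynamicLimit.Theorems.LambertianContactSwapLambertianEulerTwoTimeLaw
import Summits.AtomisticToContinuum.HydrodynamicLimit.Theorems.LambertianContactSwapLambertianEulerCollisionBudget
import Summits.AtomisticToContinuum.HydrodynamicLimit.Theorems.LambertianContactSwapLambertianEulerExpectedWindowProductionTools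
import Summits.AtomisticToContinuum.HydrodynamicLimit.Theorems.LambertianContactSwapLambertianEulerExpectedWindowProduction
import Summits.AtomisticToContinuum.HydrodynamicLimit.Theorems.LambertianContactSwapLambertianEulerProductionSplit
import Summits.AtomisticToContinuum.HydrodynamicLimit.Theorems.TwoClocksClampedEntropyClockTimeZeroReference
import Summits.AtomisticToContinuum.HydrodynamicLimit.Theorems.TwoClocksClampedEntropyClockDiscreteEntropyGronwall
import Summits.AtomisticToContinuum.HydrodynamicLimit.Theorems.TwoClocksClampedEntropyClockKlDivLawAtLocalGibbsNeTop
import Literature.MathematicalPhysics.KineticTheory.LambertianRedrawNondegenerate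
import Literature.MathematicalPhysics.KineticTheory.Hilbert6Wave0Proofs
import Literature.MathematicalPhysics.KineticTheory.HardSphereEulerLLN
import Literature.Barriers.AtomisticToContinuum.HighMomentumCutoff
import Literature.Analysis.FluidPDE.HardSphereAlexander
import HarnessLib

/-!
# Line `Sketch` — crux `LambertianContactSwap.LambertianEuler` (stmt-AtomisticToContinuum-11854) — skeleton v41

EULER FOR THE LAMBERTIAN GAS `Λ` (free flight + Alexander exit times + cosine redraw of the colliding pair's relative
velocity, `lambertFlow`) from local Gibbs data: the compressible hs-Euler system, pre-shock, as the hydrodynamic limit — an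
OVY/FFL/LO-class random-model theorem whose two recorded failure modes are (T) TAILS (true kinetic energy,
`HighMomentumCutoffBarrier`) and (E) the ERGODIC component (noise acts on collision angles only, partners are transport-selected).

v41 (lead c10, 2026-08-17): THE EQUILIBRIUM FLOOR OF CAT-core (ii) — no statement change w.r.t. v40 (same five stubs).  Landed: the
UPPER-TAIL CONCENTRATION of the window collision count of `Λ` at global equilibrium, `∃ R₀ ∀ η>0 ∀ h₀ ∃ N₀: ∫⁻ ((K_{a'+h} − K_{a'}) −
R₀h(N+1)^{4/3})₊ d(G_N⊗γ^ℕ) ≤ η h (N+1)^{4/3}` (`…WindowCountConcentration.windowCountOverflow_equilibrium_le`; with `η := (A/σ)V⁻²e^{−aV²}` this is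
term (ii) of CAT-core at equilibrium with the stub's own shell, so with c9's p156518 the WHOLE equilibrium floor of CAT-core is in the tree), by a
NEW pathwise device — cellwise fresh/non-fresh charging of the collision sequence (`…CellChargingPath.windowCount_le_of_noRecollision`: `K_window ≤
Σ_cells #{velocity-shell pairs at the cell start} + 3·#{marked collisions}`, torus no-fast-re-collision `…TorusNoFastRecollision`), single-time
stationarity, the `N`-uniform upper tail of the static shell-pair count by all `k`-th moments under insertion bounds only
(`…ShellCountTail.shellCount_overflow_le` ⇐ `…PairGraphMoments`, `…GibbsInsertionZip`, `…StarShells`, `…DisjointShells`, `…ShellCountMoments`), and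
Campbell's bound for configuration-marked contacts (`…ConfigMarkedKorolyuk`, `…MarkedContactsMean`, `…MarkedContactsStatics`).  Why `R₀` free makes it
provable: the threshold sits a constant factor above the mean, so only UPPER Gibbs bounds are needed (no cluster expansion, no two-time law).  What it
says about the open core: under the TRUE law term (ii) needs exactly the two inputs the device isolates — single-time control of the static shell
count (its MEAN follows from entropy `O(N)`: `E_λ[#fresh collisions] = O(h(N+1)^{4/3})`, recorded) and the marked contacts under a non-stationary law.

v40 (lead c9, 2026-08-17, later the same day): EQUILIBRIUM FLOORS OF THE A-PRIORI CORES AS THEOREMS, AND THE COMPOSITION AS A TREE THEOREM.  No statement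
change w.r.t. v39 (same five stubs).  Landed: the `N`-uniform equilibrium collision rate of the Lambertian gas `E_G[K_{s+h} − K_s] ≤ Cσ²h(N+1)^{4/3}`
(`…EquilibriumCollisionRate.equilibriumCollisionRate_le` p154565 — the line's first `N`-UNIFORM DYNAMICAL estimate; Korolyuk route: stationarity of
increments p153543, Korolyuk/Fatou p153835, first-collision inclusion p153718, static pair shell p153572, simplicity p153734); the equilibrium floor of
CAT-core (i) for ALL `N` and all windows, `E_G[fast-pair activity of the window] ≤ A e^{−aV²} σ³ h (N+1)` (`…FastPairActivity.fastPairActivity_equilibrium_le`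
p156518; marked Korolyuk p155379 + Gaussian-weighted shell p155581); and the whole composition of the line as conditional tree theorems
`…OfInputs.lambertianEulerInBand_of_inputs : KCW-Λ → TL1G-core → CCW-Λ → CAT-core → LambertianEulerInBand`, `…OfInputs.lambertianEuler_of_inputs :
… → DSC → LambertianEuler` (p156742).  What the floors say about the open cores: TL1G-core and CAT-core (i) hold at global equilibrium with exactly
their shells; CAT-core (ii) at equilibrium needs CONCENTRATION of the window collision count (`limsup_N E_G[(K_window/(h(N+1)^{4/3}) − R₀)₊] = 0`),
not just the mean p154565 — the next missing equilibrium tool (second moments / exponential moments of `K_window`, `N`-uniform); KCW-Λ/CCW-Λ at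
equilibrium are vacuous (the currents pair with `∇u = ∇θ = 0`).

v39 (lead c9, cycle 1, 2026-08-17): CAT-Λ RESHAPED TO ITS EULER-FREE CORE.  The Euler solution enters `CollisionActivityTailsLambda` only through the
compensated jump `Jcol` of the reference exponent, and `…JcolPairBound.abs_Jcol_le_pair` (p152321; closed form p124484 + Lipschitz coefficients) bounds it at a
contact by `2Lε_N(1 + |v_i|² + |v_j|²)` (and `0` off contacts); `…CollisionActivityCore.collisionActivityTailsLambda_of_core` (p152627) then derives CAT-Λ
(`c_J := max(2L,1)`) from the Euler-free core that is now the registered stub `stub_collisionActivityTailsCore`: along `Λ` from local Gibbs data, in `L¹`,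
(i) the `ε_N`-weighted kinetic content of FAST contact pairs (`1 + |v_i|² + |v_j|² > V²`) over a macroscopic window and (ii) `ε_N V²` times the overflow of
the window collision count above `R₀ h (N+1)^{4/3}` are `≤ A e^{−aV²} h (N+1)`, eventually in `N`.  Registered stubs (v39): KCW-Λ, TL1G-core, CCW-Λ,
CAT-core, DSC — the two a-priori inputs are now statements about the Lambertian hard-sphere gas alone (no Euler solution, no tie, no guard); the two
window-LD inputs are inherently about the reference-restarted gas.

v38 (lead c9, 2026-08-17): TL1G-Λ RESHAPED TO ITS EULER-FREE CORE.  The Euler solution enters `GaussianVelocityTailsLambda` only through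
`W = sup_{[0,t]×𝕋³}|u|`; `…GaussianTailsCore.gaussianVelocityTailsLambda_of_core` (p150128) derives TL1G-Λ from the core statement about the
Lambertian gas ALONE — Gaussian `L¹` tails (cubic weight) of the velocities `|v_i(r′)|` along `Λ` from local Gibbs data, `N`-uniform, eventually
in `N`, uniformly on `[0,t]` — which is now the registered stub `stub_gaussianVelocityTailsCore`; `…GaussianTailsExpMoment.gaussianVelocityTailsCore_of_expMoment`
(p151169) shows the core follows from `N`-uniform propagation of ONE Gaussian velocity moment `E_λ[Σ_i e^{b|v_i(r′)|²}] ≤ C(N+1)` (the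
Lambertian analogue of Gaussian-moment propagation for the hard-sphere Boltzmann equation), and `…GaussianTailsEquilibrium.gaussianVelocityTails_equilibrium`
(p149311) proves the core's FLOOR: at global equilibrium (constant profiles; `Λ`-invariance in law p118561) the bound holds for all times and ALL
`N` with any bounded comparison field.  Registered stubs (v38): KCW-Λ, `stub_gaussianVelocityTailsCore` (TL1G-core), CCW-Λ, CAT-Λ, DSC.

v35 (lead c7, 2026-08-17): THE RESHAPE OF THE TWO OPEN ENDS.  Leads c0–c6 drove this skeleton through v1–v34 (history and cycle
reports: `Lines/Sketch.md`); v34 = 3 stubs (P3Λ, P4Λ, DSC) + the landed composition `…OfHearts.lambertianEuler_of_hearts`.  Lead c7: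
* THE THIRD LEAF IS EXPECTED FALSE AND IS NOT NEEDED FOR THE GUARDED CRUX.  `stub_diluteSelfConsistency` (= stmt-3091) is rated
  expected-false by its own chain (`DSC ↔ ¬DenseExcursion` landed, `Theorems/DenseExcursion/Negative/Dichotomy.lean`; the dense excursion
  is a tuned hard-sphere implosion, numerically true), while the summit conjunct `_root_.HydrodynamicLimit` was RE-TYPED with a packing guard
  (D-0032) and the route's `closes` discards that guard only because its cruxes are unguarded.  Every use of DSC in the line manufactured
  a packing bound for thresholds fixed before the data.  c7 landed the GUARDED reduction with NO DSC in its cone: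
  `…InBandOfHearts.lambertianEulerInBand_of_hearts : KineticOneBlockInMeanLambdaLog → CollisionalOneBlockInMeanLambdaLog →
  LambertianEulerInBand` (guarded ESTIMATE `…EstimateOfHeartsLog` p138141 ⇒ BOUND ⇒ STEP ⇒ GRONWALL `…OfHeartsInBand` p138152 ⇒ guarded
  Rf-dock `…DockRfInBand` p137924 ⇒ entropy→hydro), where `LambertianEulerInBand` (`…HeartsLog` p137612) is the crux in the conjunct's
  guarded shape; and `lambertianEuler_of_inBand : LambertianEulerInBand → DSC → LambertianEuler` keeps the crux AS TYPED reachable —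
  this skeleton's composition.  RECOMMENDATION (planner): re-type `LambertianEuler` with the conjunct's guard; then
  `stub_diluteSelfConsistency` drops out and the crux closes from the two hearts by a five-line file.
* THE HEARTS' SHELL.  `∃ C, ∀ ε` (v30–v34) is replaced by the LOG-SHELL `∀ κ > 0, ∃ ε₀ > 0, ∀ ε ∈ (0,ε₀), ∃ C, 0 ≤ C ≤ κ|log ε| ∧ …`
  (`stub_kineticOneBlockInMeanLambdaLog`, `stub_collisionalOneBlockInMeanLambdaLog`; named Props `…HeartsLog.KineticOneBlockInMeanLambdaLog`
  / `.CollisionalOneBlockInMeanLambdaLog`, `_iff` by `Iff.rfl`, old ⇒ log `…Log_of`).  Why: with the true kinetic energy the heat current is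
  cubic, the entropy inequality must be applied to the current clamped at `|v − u| ≤ V(ε)`, and the admissible LD rate — hence `C` —
  degrades with `V(ε)` (`C(ε) = 1/γ₀(V(ε))`, Gaussian tails: `O(√log ε⁻¹)`); the old shell is therefore NOT what the method delivers,
  while the bootstrap and the window Gronwall tolerate exactly `C(ε) = o(log ε⁻¹)` (`exp(At) ≤ ε^{−κt}`; `…DiscreteEntropyGronwallLog`
  p137856, `…BootstrapConsts` p137941, hearts called at `κ/16` and tolerance `ε⁴`).  The log-hearts are strictly weaker research targets
  with the same downstream power.

v37 (lead c8, 2026-08-17): THE COLLISIONAL LOG-HEART IS DERIVED.  `…CollisionalHeartOfInputs.collisionalOneBlockInMeanLambdaLog_of_inputs :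
CollisionalClampedWindowLDLambda → CollisionActivityTailsLambda → GaussianVelocityTailsLambda → CollisionalOneBlockInMeanLambdaLog` (lead c7's
named missing pieces made theorems: the fresh-tail identity IN LAW for general functionals of (state, future noise) and the entropy inequality with
restart for bounded ones `…RestartInLaw` p141789; the pathwise restart cocycle of windowed JUMP sums / counts / time integrals `…WindowCocycle`
p142367; measurability / integrability / additivity / truncation algebra of jump sums `…JumpSumTools` p143472; the `N`-uniform time-Lipschitz bound
of the statics `…StaticsLipschitz` p142994; the entropy step with restart for the clamped COLLISIONAL functional `…CollisionalWindowRestart` p145035; the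
two-level clamp split of the jump functional `…CollisionalClampSplit` p145063 / `…CollisionalJumpWindows` p145066; frame `…CollisionalFrame`
p145215, per-window bound `…CollisionalWindowBound` p145668, derivation `…CollisionalHeartOfInputs` p146028; the inputs typed as named Props of
`…CollisionalInputs` p141222).  The collisional
stub of v35–v36 is REPLACED by its two research inputs:
* CCW-Λ `stub_collisionalClampedWindowLDLambda : CollisionalClampedWindowLDLambda` — log-moment-generating function of `−(γ/h)·Wcol` (truncated
  compensated jumps of the reference exponent at the contacts of the window − clamped one-body counter-terms − statics, restarted from the explicit
  local Gibbs reference with fresh noise) `≤ γ(ϑ + A′e^{−a′V²})(N+1)` for `γ ≤ c₀/V`, windows `h ∈ [h₀, 2h₀]`, eventually in `N` — the twin of KCW-Λ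
  with a Gaussian-in-`V` bias allowance (the clamps break the exact local-equilibrium cancellation that typed `X`);
* CAT-Λ `stub_collisionActivityTailsLambda : CollisionActivityTailsLambda` — along `Λ` from local Gibbs data, in `L¹` (lintegral form), the clamp
  remainder of the jump sum over a macroscopic window (jumps above the per-contact level `c_J ε_N V²` + the level times the overflow of the window
  collision count above `R₀ h (N+1)^{4/3}`) is `≤ A e^{−aV²} h (N+1)`, eventually in `N` — the Lambertian macroscopic-window form of the board's
  `TwoClocks.TransferActivityTails`.
TL1G-Λ now feeds BOTH hearts (the counter-term clamp remainder is quadratic in the peculiar velocity).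

REGISTERED STUBS (v37; v38 replaces the second by `stub_gaussianVelocityTailsCore`): `stub_kineticClampedWindowLDLambda` (KCW-Λ), `stub_gaussianVelocityTailsLambda` (TL1G-Λ), `stub_collisionalClampedWindowLDLambda`
(CCW-Λ), `stub_collisionActivityTailsLambda` (CAT-Λ) — four research inputs, two LD + two tails — and `stub_diluteSelfConsistency` (= stmt-3091; consumed
ONLY to discharge the guard of the crux as typed).  Derived in-skeleton: `kineticOneBlockInMeanLambdaLog_holds`, `collisionalOneBlockInMeanLambdaLog_holds`,
`LambertianEulerInBand_of` (the GUARDED crux from the four research stubs alone), `LambertianEuler_of` / `LambertianEuler_proof`.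

v36 (lead c7, cycle 2): THE KINETIC LOG-HEART IS DERIVED.  `…KineticHeartOfInputs.kineticOneBlockInMeanLambdaLog_of_inputs :
KineticClampedWindowLDLambda → GaussianVelocityTailsLambda → KineticOneBlockInMeanLambdaLog` (lead c6's dissection §c6.3 made a theorem in the
shell of §c7.2: clamp at `V(ε) = c₀κ|log ε|`, rate `γ = c₀/V` so `1/γ = κ|log ε|`, Gaussian-tail remainder `≤ (ε/3)(N+1)`, short intervals by the
bounded clamped observable, long ones by `m = ⌊(s′−s)/h₀⌋` equal windows each paid by the entropy step with restart ENT p136234 at rate `γ/h` and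
the clamped window LD; tools `…KineticWindowTools` p139293, `…KineticArith` p139131, defs `…KineticInputs` p138846).  The kinetic stub of v35 is
REPLACED by its two research inputs, typed as named Props of `…KineticInputs`:
* KCW-Λ `stub_kineticClampedWindowLDLambda : KineticClampedWindowLDLambda` — window LD of the CLAMPED fast kinetic current along `Λ` restarted
  from the explicit local Gibbs reference with fresh noise, `log E exp(−(γ/h)∫_0^h Σ YkinClamp) ≤ γϑ(N+1)` for `γ ≤ c₀/V`, windows
  `h ∈ [h₀,2h₀] ⊆ (0, 2w₀(ϑ)]`, eventually in `N` (the Lambertian twin of the board's `KineticCurrentsWindowLDUniform` under LOCAL Gibbs start);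
* TL1G-Λ `stub_gaussianVelocityTailsLambda : GaussianVelocityTailsLambda` — Gaussian `L¹` tails of the peculiar velocities along `Λ` from local
  Gibbs data, uniformly on `[0,t]` (the `HighMomentumCutoff` input in the weakest form the clamp remainder needs).

(v36 stubs were KCW-Λ, TL1G-Λ, P4Λ-log `stub_collisionalOneBlockInMeanLambdaLog`, DSC.)  Registered sub-goals
landed by c7: `const_le_mul_abs_log` (p137612), `discreteEntropyGronwall_log` (p137856), `bootstrap_consts` (p137941),
`stub_dockLambdaRfInBand` (p137924), `windowProductionEstimateLambdaInBand_of_heartsLog` (p138141), `gronwallRfLambdaInBand_of_windowStep`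
(p138152), `lambertianEulerInBand_of_hearts` (…InBandOfHearts).

LANDED INDEX of the line (stub / tool → proposal → module `…Theorems.LambertianContactSwapLambertianEuler<Suffix>`):
archimedes p104242 `Archimedes` · lambertLaw p105463 `LambertLaw` · lambertPovzner p104072 `Povzner` · lambertPairPovzner p103944
`PairPovzner` · contactIsotropicMaxwellian p103850 `ContactIsotropy` · momentLedgerChain p105465 `MomentLedgerChain` · gibbsInvariance
p106034 `GibbsInvariance` · entropyToHydro p106285 `EntropyToHydro` · window p112254 `Window` · markov p110886 `Markov` · iterate p113149
`Iterate` (⇒ `Liouville`: `liouvilleInvarianceLambda_holds`, `gibbsInvarianceLambda_holds`, `lambertianWellPosed_holds` p118561) · dock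
p115102 `Dock` · klLedger p120487 `KlLedger` · lawSemigroup p120622 `LawSemigroup` · dockRf p120849 `DockRf` · lambertDirMean p121484
`LambertDirMean` · pathwiseProduction p121894 `PathwiseProduction` · pairMeanSq p122074 `PairMeanSq` · windowLedger p122335 `WindowLedger` ·
collisionCompensator p123849 `CollisionCompensator` · compensatedJump p124484 `CompensatedJump` · aprioriEntropyBound p125903
`AprioriEntropyBound` · collisionIntensity p127050 `CollisionIntensity` · twoTimeLaw p127246 `TwoTimeLaw` · collisionBudget p127728
`CollisionBudget` · expectedWindowProduction p128635 `ExpectedWindowProduction` (+ `…Tools` p127688, `JointMeasurable` p128074, E1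
`LogPartitionWindow` p129046, E2 `StreamingFubini` p128881) · productionSplit p133972 `ProductionSplit` (+ `…Tools` p133001) · hearts /
estimate-of-hearts / of-hearts (c6).  Tail rungs kept as supports: `TailsZero`, `EnergyRung`, `EnergyBudget`, `SecondMoment`, `TimeLedger*`,
`FreshTail`, `FwdGood`, `IterateGood`, `RadialArchimedes`, `GaussianFrame`.

WHY THE THREE LEAVES ARE WHAT THEY ARE (c2–c5 diagnoses, `Lines/Sketch.md`): P3Λ/P4Λ are the local ergodic theorem of the Lambertian
gas split into its kinetic and collisional halves, typed ONE-SIDED / FIRST-MOMENT / on arbitrary sub-intervals with entropy allowance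
`C (s′−s) M` — the weakest form the relative-entropy method consumes (the in-window bootstrap is PROVED); the cubic heat current lives in
`L¹` inside P3Λ because no exponential moment of it exists under any Gaussian reference (`HighMomentumCutoff`) and the Povzner ladder
cannot give `N`-uniform tails at hydrodynamic collision rates (c2); stmt-3091 keeps the Euler density inside the low-density regime where
the reference local Gibbs family exists.

DISPROOF USED: none exists for stmt-11854 (`ledger crux ls`, 2026-08-17T03:48Z, 06:50Z, 13:15Z (c10): no `Disproof.lean`, no `Negative/`).
-/

noncomputable section

namespace Summit.AtomisticToContinuum.HydrodynamicLimit.Cruxes.LambertianEuler.Sketch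

open scoped BigOperators Topology ENNReal InnerProductSpace
open MeasureTheory ProbabilityTheory Filter Set InformationTheory
open Literature.MathematicalPhysics.KineticTheory
open Literature.Analysis.FluidPDE Literature.Analysis.FluidPDE.Alexander
open Summit.AtomisticToContinuum.HydrodynamicLimit.Theses.LambertianContactSwap
open Summit.AtomisticToContinuum.HydrodynamicLimit.Theorems.ClampedCurrentsDockPathwise (gSum DgSum)

/-! ## §1 The five registered open stubs (KCW-Λ, TL1G-core, CCW-Λ, CAT-core; stmt-3091 byte-identical since v10); TL1G-Λ, CAT-Λ and the two log-hearts derived -/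

/-- STUB (OPEN, research — KCW-Λ; v36, lead c7; = `…KineticInputs.KineticClampedWindowLDLambda`). **Clamped kinetic window large
deviations under local-Gibbs restart.** For every insertion factor there are a band `ηk` and `σ₀` such that for `σ < σ₀`, every classical
hs-Euler solution with packing `< ηk`, every flow family and `t ∈ (0,T)`: there is `c₀ > 0` such that for every clamp level `V ≥ 1`, rate
`0 < γ ≤ c₀/V` and `ϑ > 0` there is `w₀ > 0` such that for `0 < h₀ ≤ w₀`, eventually in `N`, for all windows `[a,a+h] ⊆ [0,t]` with
`h₀ ≤ h ≤ 2h₀`: `log ∫ exp(−(γ/h) ∫_0^h Σ_i YkinClamp V θ u (a+r′) ((Λ_{r′} q)_i) dr′) d(ψ_a ⊗ γ^ℕ)(q) ≤ γ ϑ (N+1)`, `ψ_a` the explicit local Gibbs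
reference.  Heuristics: drift `O(h)` (landed STATICS p136127: the local-Maxwellian mean of `Ykin` is second order in the parameter deviations) +
decorrelation `O(γ τ_free/h)` by the Lambertian contacts (conditional contraction `1/4`, resp. `1/16`, of the pair traceless stress per redraw);
the cap `c₀/V` is the static Gaussian saddle of the clamped cubic heat current.  The natural first child is its GLOBAL-equilibrium version
(constant profiles: `ψ` is `Λ`-invariant by `gibbsInvarianceLambda_holds`, and the functional is a martingale-difference-dominated additive
functional of a stationary Markov process).  Why it might fail: an `O(1)`-per-particle non-equilibrium stress of `Λ` restarted from local Gibbs
persisting over macroscopic windows (no decorrelation at `≍ N^{1/3}` contacts per unit time). [cite: OllaVaradhanYau1993, §4] [cite: Yau1991, §2] -/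
theorem stub_kineticClampedWindowLDLambda :
    Summit.AtomisticToContinuum.HydrodynamicLimit.Theorems.LambertianContactSwapLambertianEulerKineticInputs.KineticClampedWindowLDLambda := by
  sorry

/-- STUB (OPEN, research — TL1G-core; v38, lead c9; the hypothesis of `…GaussianTailsCore.gaussianVelocityTailsLambda_of_core`). **Gaussian
velocity tails of the Lambertian gas from local Gibbs data (Euler-free core of TL1G-Λ).** For continuous positive data profiles there is `σ₀ > 0`
such that for `0 < σ < σ₀`, every flow family `Φ` (phase spaces only) and every horizon `t > 0` there are `A, a > 0` such that for every `V ≥ 1`,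
eventually in `N`, for all `r′ ∈ [0,t]`: `E_{λ_N ⊗ γ^ℕ}[Σ_i (1 + |v_i(r′)|)³ · 1{|v_i(r′)| > V}] ≤ A e^{−aV²} (N+1)` along `Λ`.  No Euler solution,
no tie, no packing guard: a statement about the Lambertian hard-sphere gas at fixed reduced density alone.  Expected TRUE (local equilibrium;
its floor at global equilibrium is the landed `gaussianVelocityTails_equilibrium`, p149311, all times and all `N`; under the TRUE law only the
inverse-square count law `E[#{|v_i(s)|>V}] ≤ E[Σ|v_i|²]/V² ≤ C(N+1)/V²` follows from the energy rung of c1 (`lambertFlow_energyRung`)) but DYNAMICAL: static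
information — relative entropy `O(N)` w.r.t. a global Gibbs law, `L^p(g)`-norms of the density, the pointwise domination `ψ ≤ K^{N+1} g` — is
preserved by `Λ` and provably yields only POLYNOMIAL tails `N`-uniformly (a coherent block of `K ≍ N/U²` particles at speed `U` costs entropy
`O(N)`), so the Gaussian rate must come from the redraws themselves (energy concentration in one particle needs `≍ U²/θ` favourable cosine
redraws), i.e. from `N`-uniform propagation of Gaussian moments at `≍ (N+1)^{1/3}` contacts per particle per unit time — the Lambertian analogue of
Gaussian-moment propagation for the hard-sphere Boltzmann equation, where the Povzner mixed terms factorise by chaos; here the two-particle velocity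
law AT CONTACT is the unknown (lead c2's diagnosis of the moment ladder, `Lines/Sketch.md` §2).  A sufficient form is landed as
`gaussianVelocityTailsCore_of_expMoment` (p151169): `N`-uniform propagation of ONE Gaussian velocity moment.  The `HighMomentumCutoff` input of the
line in its weakest useful form. [cite: OllaVaradhanYau1993, §3] -/
theorem stub_gaussianVelocityTailsCore :
    ∀ (a₀ θ₀ : T3 → ℝ) (u₀ : T3 → V3), Continuous a₀ → Continuous θ₀ → Continuous u₀ →
      (∀ x, 0 < a₀ x) → (∀ x, 0 < θ₀ x) →
      ∃ σ₀ : ℝ, 0 < σ₀ ∧ ∀ σ : ℝ, 0 < σ → σ < σ₀ →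
        ∀ Φ : (N : ℕ) → HardSphereFlow (Torus.geometry (Fin 3)) (hsDiameter σ N) (N + 1),
        ∀ t : ℝ, 0 < t → ∃ A a : ℝ, 0 < A ∧ 0 < a ∧ ∀ V : ℝ, 1 ≤ V → ∃ N₀ : ℕ, ∀ N : ℕ, N₀ ≤ N →
          ∀ r' ∈ Set.Icc 0 t,
            ∫ p, (∑ i : Fin (N + 1),
                if V < ‖(lambertFlow (Torus.geometry (Fin 3)) (hsDiameter σ N) p.2 p.1 r' i).2‖ then
                  (1 + ‖(lambertFlow (Torus.geometry (Fin 3)) (hsDiameter σ N) p.2 p.1 r' i).2‖) ^ 3 else 0)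
              ∂((localGibbsLaw σ a₀ u₀ θ₀ N (Φ N)).prod (lambertNoise (Fin 3))) ≤
            A * Real.exp (-(a * V ^ 2)) * ((N : ℝ) + 1) := by
  sorry

/-- **TL1G-Λ, DERIVED** (v38): Gaussian tails of the PECULIAR velocities along any classical hs-Euler solution, from the Euler-free core
(`…GaussianTailsCore.gaussianVelocityTailsLambda_of_core`, p150128: the solution enters only through `sup_{[0,t]×𝕋³}|u| < ∞`). -/
theorem gaussianVelocityTailsLambda_holds :
    Summit.AtomisticToContinuum.HydrodynamicLimit.Theorems.LambertianContactSwapLambertianEulerKineticInputs.GaussianVelocityTailsLambda :=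
  Summit.AtomisticToContinuum.HydrodynamicLimit.Theorems.LambertianContactSwapLambertianEulerGaussianTailsCore.gaussianVelocityTailsLambda_of_core
    stub_gaussianVelocityTailsCore

/-- **P3Λ-log, DERIVED** (v36): the kinetic log-heart from its two research inputs
(`…KineticHeartOfInputs.kineticOneBlockInMeanLambdaLog_of_inputs`). -/
theorem kineticOneBlockInMeanLambdaLog_holds :
    Summit.AtomisticToContinuum.HydrodynamicLimit.Theorems.LambertianContactSwapLambertianEulerHeartsLog.KineticOneBlockInMeanLambdaLog :=
  Summit.AtomisticToContinuum.HydrodynamicLimit.Theorems.LambertianContactSwapLambertianEulerKineticHeartOfInputs.kineticOneBlockInMeanLambdaLog_of_inputs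
    stub_kineticClampedWindowLDLambda gaussianVelocityTailsLambda_holds

/-- STUB (OPEN, research — CCW-Λ; v37, lead c8; = `…CollisionalInputs.CollisionalClampedWindowLDLambda`). **Clamped collisional window large
deviations under local-Gibbs restart.** For every insertion factor there are a band `ηc` and `σ₀` such that for `σ < σ₀`, every classical hs-Euler
solution with packing `< ηc`, every flow family, `t ∈ (0,T)`, every overflow factor `R₀ ≥ 1` and level constant `c_J > 0`: there are `c₀, A′, a′ > 0`
such that for every clamp level `V ≥ 1`, rate `0 < γ ≤ c₀/V` and `ϑ > 0` there is `w₀ > 0` such that for `0 < h₀ ≤ w₀`, eventually in `N`, for all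
windows `[a,a+h] ⊆ [0,t]` with `h₀ ≤ h ≤ 2h₀`: `log ∫ exp(−(γ/h)·Wcol σ Rf ρ θ u N V c_J R₀ a h) d(ψ_a ⊗ γ^ℕ) ≤ γ (ϑ + A′e^{−a′V²}) (N+1)`, `Wcol` =
`trunc_L(Σ_{contacts of (0,h]} trunc_ℓ Jcol_{a+t}) − ∫_0^h Σ_i XcolClamp V (a+r′) − dLZ(a, a+h)`, `ℓ = c_J ε_N V²`, `L = ℓ R₀ h (N+1)^{4/3}`.  Heuristics:
under the reference start the contact statistics are those of local equilibrium up to `o(h) + O(Kn)`, for which the compensated jumps are balanced by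
the counter-terms and the statics; fluctuations `O(γ τ_free/h)`; the cap `c₀/V` is the static Gaussian saddle of a fast particle's truncated jumps; the
allowance `A′e^{−a′V²}` is the bias of the clamps.  Why it might fail: a contact-statistics bias of the reference-started Lambertian gas of relative
size `≫ e^{−aV²}` that does not vanish as `h → 0` (e.g. from the `O(Kn)` Chapman–Enskog correction if it were not `o_N(1)` at exponential-moment
level), or collision-count overflow not being super-exponentially rare under the redraws. [cite: OllaVaradhanYau1993, §3–§4] [cite: Yau1991, §2] -/
theorem stub_collisionalClampedWindowLDLambda :
    Summit.AtomisticToContinuum.HydrodynamicLimit.Theorems.LambertianContactSwapLambertianEulerCollisionalInputs.CollisionalClampedWindowLDLambda := by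
  sorry

/-- STUB (OPEN, research — CAT-core; v39, lead c9; the second hypothesis of `…CollisionActivityCore.collisionActivityTailsLambda_of_core`).
**Collision-activity tails of the Lambertian gas from local Gibbs data (Euler-free core of CAT-Λ).** For continuous positive data profiles there is
`σ₀ > 0` such that for `0 < σ < σ₀`, every flow family `Φ` and every horizon `t > 0` there are an overflow factor `R₀ ≥ 1` and `A, a > 0` such that
for every `V ≥ 1` and `h₀ > 0`, eventually in `N`, for all windows `[a′, a′+h] ⊆ [0,t]` with `h₀ ≤ h ≤ 2h₀`, under `λ_N ⊗ γ^ℕ` (lintegrals):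
(i) `E[Σ_{m<K_{a′+h}, a′<t_{m+1}} Σ_{q incoming pair of z_m♭} ε_N (1 + |v_{q.1}|² + |v_{q.2}|²) · 1{V² < 1 + |v_{q.1}|² + |v_{q.2}|²}]` (the `ε_N`-weighted
kinetic content of the FAST contact pairs of the window; a.s. exactly one incoming pair per contact) plus (ii) `E[(ε_N V² ((K_{a′+h} − K_{a′}) −
R₀ h (N+1)^{4/3}))₊]` (the level times the overflow of the window collision count above `R₀ ×` typical) is `≤ A e^{−aV²} h (N+1)`.  No Euler solution,
no tie, no guard.  Expected TRUE (local equilibrium with bounded profiles: contacts of fast pairs are carried by Gaussian tails, `≍ h N^{4/3} · e^{−cV²}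
poly(V)` of them, each weighted `ε_N V²`, total `≍ σ h (N+1) poly(V) e^{−cV²}`; the window count self-averages over the torus so (ii) asks only for an
`L¹` law-of-large-numbers UPPER bound `limsup_N E[(K_window/(h(N+1)^{4/3}) − R₀)₊] = 0`) but DYNAMICAL and `N`-UNIFORM: an a-priori bound on the
collision activity of the non-equilibrium Lambertian gas at `≍ (N+1)^{1/3}` contacts per particle per unit time, for which the tree has only the
fixed-`N` energy-shell intensity (p127050) and, since v40, the `N`-UNIFORM equilibrium floors: the mean collision rate `E_G[K_{s+h} − K_s] ≤
Cσ²h(N+1)^{4/3}` (p154565) and term (i) at global equilibrium for all `N`, `≤ A e^{−aV²}σ³h(N+1)` (p156518); the floor of (ii) is LANDED since v41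
(`…WindowCountConcentration.windowCountOverflow_equilibrium_le`, lead c10: upper-tail concentration of the window count at equilibrium, same
shell `∃R₀ ∀V ∀h₀ ∃N₀`), and everything under the TRUE law needs the non-equilibrium collision rate (research).
The Lambertian macroscopic-window form of the board's `TwoClocks.TransferActivityTails` (stmt-16624). [cite: OllaVaradhanYau1993, §3] -/
theorem stub_collisionActivityTailsCore :
    ∀ (a₀ θ₀ : T3 → ℝ) (u₀ : T3 → V3), Continuous a₀ → Continuous θ₀ → Continuous u₀ →
      (∀ x, 0 < a₀ x) → (∀ x, 0 < θ₀ x) →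
      ∃ σ₀ : ℝ, 0 < σ₀ ∧ ∀ σ : ℝ, 0 < σ → σ < σ₀ →
        ∀ Φ : (N : ℕ) → HardSphereFlow (Torus.geometry (Fin 3)) (hsDiameter σ N) (N + 1),
        ∀ t : ℝ, 0 < t → ∃ R₀ A a : ℝ, 1 ≤ R₀ ∧ 0 < A ∧ 0 < a ∧
          ∀ V : ℝ, 1 ≤ V → ∀ h₀ : ℝ, 0 < h₀ → ∃ N₀ : ℕ, ∀ N : ℕ, N₀ ≤ N →
            ∀ (a' h : ℝ), 0 ≤ a' → h₀ ≤ h → h ≤ 2 * h₀ → a' + h ≤ t →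
              (∫⁻ p, ENNReal.ofReal
                  (∑ m ∈ Finset.range (lambertCount (Torus.geometry (Fin 3)) (hsDiameter σ N) p.2 p.1 (a' + h)),
                    if a' < (lambertInstant (Torus.geometry (Fin 3)) (hsDiameter σ N) p.2 p.1 (m + 1)).toReal then
                      ∑ q : Fin (N + 1) × Fin (N + 1),
                        (incomingPairs (Torus.geometry (Fin 3)) (hsDiameter σ N)
                          (freeFlight (Torus.geometry (Fin 3))
                            (freeExitTime (Torus.geometry (Fin 3)) (hsDiameter σ N)
                              (lambertStateAfter (Torus.geometry (Fin 3)) (hsDiameter σ N) p.2 p.1 m)).toReal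
                            (lambertStateAfter (Torus.geometry (Fin 3)) (hsDiameter σ N) p.2 p.1 m))).indicator
                          (fun q' => if V ^ 2 < 1 + ‖(lambertStateAfter (Torus.geometry (Fin 3)) (hsDiameter σ N) p.2 p.1 m q'.1).2‖ ^ 2 +
                                ‖(lambertStateAfter (Torus.geometry (Fin 3)) (hsDiameter σ N) p.2 p.1 m q'.2).2‖ ^ 2 then
                              hsDiameter σ N * (1 + ‖(lambertStateAfter (Torus.geometry (Fin 3)) (hsDiameter σ N) p.2 p.1 m q'.1).2‖ ^ 2 +
                                ‖(lambertStateAfter (Torus.geometry (Fin 3)) (hsDiameter σ N) p.2 p.1 m q'.2).2‖ ^ 2) else 0) q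
                    else 0)
                ∂((localGibbsLaw σ a₀ u₀ θ₀ N (Φ N)).prod (lambertNoise (Fin 3)))) +
              (∫⁻ p, ENNReal.ofReal (hsDiameter σ N * V ^ 2 *
                  (((lambertCount (Torus.geometry (Fin 3)) (hsDiameter σ N) p.2 p.1 (a' + h) : ℕ) : ℝ) -
                    ((lambertCount (Torus.geometry (Fin 3)) (hsDiameter σ N) p.2 p.1 a' : ℕ) : ℝ) -
                    R₀ * h * ((N : ℝ) + 1) ^ (4 / 3 : ℝ)))
                ∂((localGibbsLaw σ a₀ u₀ θ₀ N (Φ N)).prod (lambertNoise (Fin 3)))) ≤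
              ENNReal.ofReal (A * Real.exp (-(a * V ^ 2)) * h * ((N : ℝ) + 1)) := by
  sorry

/-- **CAT-Λ, DERIVED** (v39): the collision-activity tails along any classical hs-Euler solution, from the static pair bound of the compensated jump
(`…JcolPairBound.abs_Jcol_le_pair`, p152321) and the Euler-free core (`…CollisionActivityCore.collisionActivityTailsLambda_of_core`, p152627). -/
theorem collisionActivityTailsLambda_holds :
    Summit.AtomisticToContinuum.HydrodynamicLimit.Theorems.LambertianContactSwapLambertianEulerCollisionalInputs.CollisionActivityTailsLambda :=
  Summit.AtomisticToContinuum.HydrodynamicLimit.Theorems.LambertianContactSwapLambertianEulerCollisionActivityCore.collisionActivityTailsLambda_of_core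
    Summit.AtomisticToContinuum.HydrodynamicLimit.Theorems.LambertianContactSwapLambertianEulerJcolPairBound.abs_Jcol_le_pair
    stub_collisionActivityTailsCore

/-- **P4Λ-log, DERIVED** (v37): the collisional log-heart from its research inputs and the Gaussian velocity tails
(`…CollisionalHeartOfInputs.collisionalOneBlockInMeanLambdaLog_of_inputs`). -/
theorem collisionalOneBlockInMeanLambdaLog_holds :
    Summit.AtomisticToContinuum.HydrodynamicLimit.Theorems.LambertianContactSwapLambertianEulerHeartsLog.CollisionalOneBlockInMeanLambdaLog :=
  Summit.AtomisticToContinuum.HydrodynamicLimit.Theorems.LambertianContactSwapLambertianEulerCollisionalHeartOfInputs.collisionalOneBlockInMeanLambdaLog_of_inputs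
    stub_collisionalClampedWindowLDLambda collisionActivityTailsLambda_holds gaussianVelocityTailsLambda_holds

/-- STUB (OPEN — EXISTING SHARED ITEM; v10). Body VERBATIM of
`Summit.AtomisticToContinuum.HydrodynamicLimit.Theses.ImplosionDichotomy.DiluteSelfConsistency`
(stmt-AtomisticToContinuum-3091, [difficulty: open-problem], "the hidden PDE crux of every route" with the
conjunct's quantifier prefix; attacked through its negation `DenseExcursion`, stmt-12586): the packing
`ρ_t σ³` of every classical hs-Euler solution tied at `t = 0` to local Gibbs data stays below any `η` for
`σ < σ₀(η, profiles)`. v35 (lead c7): EXPECTED FALSE by its own chain (`DSC ↔ ¬DenseExcursion` landed) and consumed here ONLY to discharge the packing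
guard of the crux as typed (`…InBandOfHearts.lambertianEuler_of_inBand`); the guarded crux `LambertianEulerInBand` needs it
nowhere (`LambertianEulerInBand_of` below).  Recommendation: re-type the crux with the D-0032 guard and drop this stub. -/
theorem stub_diluteSelfConsistency :
    ∀ η : ℝ, 0 < η → ∀ (a₀ θ₀ : T3 → ℝ) (u₀ : T3 → V3), Continuous a₀ → Continuous θ₀ → Continuous u₀ → (∀ x, 0 < a₀ x) → (∀ x, 0 < θ₀ x) → ∃ σ₀ : ℝ, 0 < σ₀ ∧ ∀ σ : ℝ, 0 < σ → σ < σ₀ → ∀ (T : ℝ) (ρ θ : ℝ → T3 → ℝ) (u : ℝ → T3 → V3), IsHardSphereEulerSolution σ T ρ u θ → ∀ Φ : (N : ℕ) → HardSphereFlow (Torus.geometry (Fin 3)) (hsDiameter σ N) (N + 1), TendstoHydroFieldsAt (fun N => localGibbsLaw σ a₀ u₀ θ₀ N (Φ N)) Φ ρ u θ 0 → ∀ t ∈ Set.Ico 0 T, ∀ x, ρ t x * σ ^ 3 < η := by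
  sorry

/-! ## §2 The composition (the glue is the landed `…InBandOfHearts`) -/

/-- **The GUARDED crux from the four research stubs alone** (no stmt-3091): `LambertianEulerInBand` — the crux in the shape of the
re-typed conjunct — through `…InBandOfHearts.lambertianEulerInBand_of_hearts` fed with the two DERIVED log-hearts. -/
theorem LambertianEulerInBand_of :
    Summit.AtomisticToContinuum.HydrodynamicLimit.Theorems.LambertianContactSwapLambertianEulerHeartsLog.LambertianEulerInBand :=
  Summit.AtomisticToContinuum.HydrodynamicLimit.Theorems.LambertianContactSwapLambertianEulerInBandOfHearts.lambertianEulerInBand_of_hearts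
    kineticOneBlockInMeanLambdaLog_holds collisionalOneBlockInMeanLambdaLog_holds

/-- **The line closes the crux AS TYPED modulo its five stubs**: `LambertianEuler` from the guarded crux and dilute self-consistency
(`…InBandOfHearts.lambertianEuler_of_inBand`). -/
theorem LambertianEuler_of : LambertianEuler :=
  Summit.AtomisticToContinuum.HydrodynamicLimit.Theorems.LambertianContactSwapLambertianEulerInBandOfHearts.lambertianEuler_of_inBand
    LambertianEulerInBand_of stub_diluteSelfConsistency

/-- **The registered deciding theorem of the skeleton**: the same composition read as the sister route's copy of the crux,
`LindebergRandomFuture.LambertianEuler` (byte-identical bodies). -/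
theorem LambertianEuler_proof :
    Summit.AtomisticToContinuum.HydrodynamicLimit.Theses.LindebergRandomFuture.LambertianEuler :=
  LambertianEuler_of

end Summit.AtomisticToContinuum.HydrodynamicLimit.Cruxes.LambertianEuler.Sketch
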